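import Summits.QuantumFields.YangMills.Theorems.UnitScaleTiltProp7StubEXOfChartPiecesTwS
import Summits.QuantumFields.YangMills.Theorems.UnitScaleTiltProp7SymSliceWitnessRegPr
import HarnessLib

/-!
# Route `UnitScaleTilt`, crux K1 child «MinimiserStabilityRegPr» (stmt-QuantumFields-19200), skeleton v10, stub `stub_existenceMinimalOrbit` (EX), route (α) — **THE EX KNIT AT THE
# CHART OF RECORD AND THE SYMMETRIC SLICE, v2.7ˢ: THE CHART-ΣS WITNESS ROW DISCHARGED** (★★OWNER RULING g26-№19 ORDER (1) «explicit witness `ũ_S`» — ★w5-20520 g4's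
# ✓`Prop7AxialResidualFreedom` ∕ ✓`Prop7SymSliceWitness` ∕ ✓`Prop7SymSliceWitnessRegPr`: the axial gauge fixing with PRESCRIBED top-centre data, [Balaban1985RegularSpaces] p. 79
# «(1.19) determine uniquely an element in each orbit», applied to the data `(w^{sym}_{iX})⁻¹`, SU(2)-valued by ✓`Prop7SymFrameBound.frameTwS_mem_specialUnitaryUnits_of_regPr`)

Cell `ym3-torus`, width seat `ym-ust-19200-w2` (gen 3; EX KNIT RULER).  THEOREMS ONLY (0 `def`, 0 `sorry`).  CONDITIONAL: this file does NOT close the stub — the remaining inputs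
are displayed hypotheses with named suppliers; `--supports stmt-QuantumFields-19200 --as helper`, count-neutral.  YM₃ on T³ is a ladder rung (R3), not the Clay problem; nothing
here claims the stub, the crux, d = 4 or the mass gap.

THE PRINT.  [Balaban1985Variational] (20) p. 281; [Balaban1985RegularSpaces] (1.19) p. 79, (1.28)–(1.30) p. 81 («U′ = (U₁U₀)^u in the axial gauge (1.19) …»), Prop. 7 p. 98;
[Balaban1985Averaging] (87) p. 31 (the witness' centre values).  After this file the EX display carries NO slice-witness row: the (20)ˢ clause of CHART-112ˢ is a theorem end to end
(witness ∘ ✓`fibreClauseS_of_chart47twS` ∘ Prop. 7 regularity).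

WHAT IS PROVED (sorry-free, no definition).  ★★★ **`stubEX_of_chartPiecesTwSW`** — ✓`stubEX_of_chartPiecesTwS`'s statement WITHOUT the `hWit` binder; proof = v2.6ˢ applied to the
witness theorem at the member: windows `10⁹L²e ≤ 1`, `10¹²L³α ≤ 1` read on the member's `L`, (19)-size `‖X(b)‖ ≤ e·η` from `nMax19 U₀ X < e` (✓`norm_smul_I_le_of_nMax19_lt`), the
chart point's regularity `RegPr (178(α + e)) (e^{iX}U₀)` from (W137) via ✓`in19_expHermField_of_nMax19_lt` ∘ ✓`regPr_emb15_of_in19`.  DISPLAYED ROWS LEFT (EX node list): N06 ×2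
(`norm_G`, `norm_H₁`), Prop. 4, (45)–(46)-twS `h46tw`, (102)∕(129)-twS + -L, `hXtw″` (XL), (γ)-growth, Thm 2 sockets, and the L-only numerals (WF), (W137), (W47q)∕(W47R), `hMe`, `hrε`, `hBH0`.

References: T. Bałaban, CMP 102 (1985) 277–309 [Balaban1985Variational] ((19)–(21) p.281, (47)–(49) p.285, (112) p.294, Prop. 7 p.299); CMP 99 (1985) 75–102 [Balaban1985RegularSpaces]
((1.19) p.79, (1.28)–(1.31) pp.81–82, Prop. 7 p.98); CMP 98 (1985) 17–51 [Balaban1985Averaging] ((87) p.31).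
-/

set_option autoImplicit false

noncomputable section

open scoped BigOperators Matrix.Norms.L2Operator Matrix

namespace Summit.QuantumFields.YangMills.Theorems.Prop7StubEXOfChartPiecesTwSW

open NormedSpace
open Literature.MathematicalPhysics.QuantumFieldTheory.Balaban1983to89
open Literature.MathematicalPhysics.QuantumFieldTheory.Balaban1983to89.T3ContinuumYM3Torus
open Literature.MathematicalPhysics.QuantumFieldTheory.Balaban1983to89.T3UnitLawDensityEML (ℰp)
open Literature.MathematicalPhysics.QuantumFieldTheory.Balaban1983to89.T3TiltDescent (descendTo)
open Literature.MathematicalPhysics.QuantumFieldTheory.Balaban1983to89.T3ConstrainedMinimiser (fibre)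
open Literature.MathematicalPhysics.QuantumFieldTheory.Balaban1983to89.T3PrintedRegularMinimiser (RegPr regFibrePr)
open Literature.MathematicalPhysics.QuantumFieldTheory.Balaban1983to89.T3PrintedRegularOrbits (descTransf)
open Literature.MathematicalPhysics.QuantumFieldTheory.Balaban1983to89.T3PrintedMinimiserExistence (regPr_mono)
open Literature.MathematicalPhysics.QuantumFieldTheory.Balaban1983to89.T3Thm1Carrier
open Literature.MathematicalPhysics.QuantumFieldTheory.Balaban1983to89.T3SectALandauChart (In19 emb15 CloseAvg eta)
open BlockAveragingEMLLinearisedBackground (pertVar)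
open B9SectCLatticeCarrier (Bond)
open B10Eq27TorusAxialLog (unitsField toUField)
open B11Eq115Space (NegSize Space115 JetSup)
open B11Eq111FrakG (nabla115)
open B11Eq98CurrentSlot (Jcur)
open B11Prop3Model (Dfix)
open B13Contraction113 (QuadAnalytic)
open B8Thm2TorusAt (Thm2TorusAt)
open B7Prop2SpecialUnitary (specialUnitaryUnits)
open MatrixLog (mlog)
open Summit.QuantumFields.YangMills.Theorems.Prop7TPrint (nMax19 expHermField)
open Summit.QuantumFields.YangMills.Theorems.Prop7SPrint (AvgCondPrint AvgCondPrintS NormS IsLandauPrint)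
open Summit.QuantumFields.YangMills.Theorems.Prop7SectET3Transport (periodsT3 siteEquiv siteEquiv_shiftEquiv bgOfCfg bondEquiv)
open Summit.QuantumFields.YangMills.Theorems.Prop7SymAvgTwSym (dbarTwS QTwS CmapTwS Chart47T3twS)
open Summit.QuantumFields.YangMills.Theorems.Prop7Bound20SymLog (bound20_symLog_of_closeAvg)
open Summit.QuantumFields.YangMills.Theorems.Prop7ChartPiecesTwS (hChart_of_piecesTwS)
open Summit.QuantumFields.YangMills.Theorems.Prop7StubEXOfDisplayedRowsWS (stubEX_of_displayedRows_wS)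
open Summit.QuantumFields.YangMills.Theorems.Prop7ChartDatumSplitS (hXtw_of_split_etaS)
open Summit.QuantumFields.YangMills.Theorems.Prop7DbarTwSymWindow (dbarTwS_window_of_regPr)
open Summit.QuantumFields.YangMills.Theorems.Prop7CmapTwSymInputs (chart47twS_of_regPr_eta)
open Summit.QuantumFields.YangMills.Theorems.Prop7ChartLandauSplitS (hXtw'_of_splitLS)
open Summit.QuantumFields.YangMills.Theorems.Prop7StubEXOfChartPiecesTwL (windows_of_admissible three_le_memberL)
open Summit.QuantumFields.YangMills.Theorems.Prop7StubEXOfChartPiecesTwS (windows_of_W stubEX_of_chartPiecesTwS)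
open Summit.QuantumFields.YangMills.Theorems.Prop7SymSliceWitness (exists_normS_of_regPr_of_size)
open Summit.QuantumFields.YangMills.Theorems.Prop7DbarTwWindow (norm_smul_I_le_of_nMax19_lt)
open Summit.QuantumFields.YangMills.Theorems.Prop7B8Prop7Div (regPr_emb15_of_in19)
open Summit.QuantumFields.YangMills.Theorems.Prop7PV3CDELogChart (in19_expHermField_of_nMax19_lt)

variable {L : ℕ}

/-- ★★★ **`stub_existenceMinimalOrbit`'s REGISTERED TEXT FROM THE PIECES OF THE CHART OF RECORD, v2.7ˢ — THE CHART-ΣS WITNESS ROW DISCHARGED**: ✓`stubEX_of_chartPiecesTwS` (v2.6ˢ)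
with its displayed witness row `hWit` («∀ U₀ ∈ 𝔘_k(α), ∀ X Hermitian-traceless of (19)-size < e: ∃ u, NormS U₀ X (e^{iX}) u») PROVED by ★w5-20520 g4's
✓`Prop7SymSliceWitness.exists_normS_of_regPr_of_size` — inputs: `10¹²L³α ≤ 1` (WF), `10⁹L²e ≤ 1` (WF), the (19)-size `‖X(b)‖ ≤ e·η` (`nMax19 < e`), and the regularity of the
chart point `U₁U₀ = e^{iX}U₀ ∈ 𝔘_k(178(α + e))` ([Balaban1985RegularSpaces] Prop. 7, ✓`regPr_emb15_of_in19`, window (W137)).  Displayed rows = v2.6ˢ's minus `hWit`: N06 ×2, Prop. 4,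
`h46tw` (QTwS), (WF) `hWe`∕`hWε`, `hMe`, (W137), `hBH0`, (W47q)∕(W47R), `h102`∕`h129`, `h102L`∕`h129L`, `hrε`, `hXtw″`, (γ)-growth (S letters), Thm 2 sockets.  CONDITIONAL — the stub is
not closed. [cite: Balaban1985Variational, Prop. 7 p.299, (19)–(21) p.281, (47)–(49) p.285, (112) p.294; Balaban1985RegularSpaces, (1.19) p.79, (1.28)–(1.31) pp.81–82, Prop. 7 p.98; Balaban1985Averaging, (87) p.31] -/
theorem stubEX_of_chartPiecesTwSW
    [hFL : ∀ F : T3Family, Fact (0 < (F.L : ℝ))] [hFη : ∀ (F : T3Family) (k : ℕ), Fact (0 < ((F.L : ℝ)⁻¹) ^ k)]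
    -- the constants, member-uniform at each `L` (print: «absolute constants depending on d and L only»)
    (B₀ C₄ a₃ α r M CP θ cS : ℕ → ℝ) (hB₀ : ∀ L, 1 < L → 0 < B₀ L) (hC₄ : ∀ L, 1 < L → 0 < C₄ L) (ha₃ : ∀ L, 1 < L → 0 < a₃ L)
    (hα : ∀ L, 1 < L → 0 < α L) (hr : ∀ L, 1 < L → 0 < r L) (hM : ∀ L, 1 < L → 0 < M L) (hCP : ∀ L, 1 < L → 0 < CP L)
    (hθ : ∀ L, 1 < L → θ L < 1 / 2) (hcS : ∀ L, 1 < L → 0 ≤ cS L)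
    -- the curved letters `𝔊(U₀)`, `(δ/δA′)V`, `H₁(U₀)`, OPAQUE (the datum `B` is FIXED to `Bsym` on `Λ_k = PBond (P n) 0`)
    (𝒢f : ∀ (L : ℕ) (i : Idx L) (U₀ : GaugeField (i.1.1.P i.1.2.2) 0 (Matrix.specialUnitaryGroup (Fin 2) ℂ)),
      NegSize (i.1.1.L : ℝ) (((i.1.1.L : ℝ)⁻¹) ^ (i.1.2.2 - i.1.2.1)) (fun _ : Bond 3 (periodsT3 i.1.1 i.1.2.2) => i.1.2.2 - i.1.2.1) 3
          (Matrix (Fin 2) (Fin 2) ℂ) →L[ℂ]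
        Space115 (i.1.1.L : ℝ) (((i.1.1.L : ℝ)⁻¹) ^ (i.1.2.2 - i.1.2.1)) (fun _ : Bond 3 (periodsT3 i.1.1 i.1.2.2) => i.1.2.2 - i.1.2.1)
          (fun _ : Bond 3 (periodsT3 i.1.1 i.1.2.2) × Fin 3 => i.1.2.2 - i.1.2.1) (nabla115 (((i.1.1.L : ℝ)⁻¹) ^ (i.1.2.2 - i.1.2.1)) (bgOfCfg i.1.1 i.1.2.2 U₀)))
    (Wf : ∀ (L : ℕ) (i : Idx L) (U₀ : GaugeField (i.1.1.P i.1.2.2) 0 (Matrix.specialUnitaryGroup (Fin 2) ℂ)),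
      Space115 (i.1.1.L : ℝ) (((i.1.1.L : ℝ)⁻¹) ^ (i.1.2.2 - i.1.2.1)) (fun _ : Bond 3 (periodsT3 i.1.1 i.1.2.2) => i.1.2.2 - i.1.2.1)
          (fun _ : Bond 3 (periodsT3 i.1.1 i.1.2.2) × Fin 3 => i.1.2.2 - i.1.2.1) (nabla115 (((i.1.1.L : ℝ)⁻¹) ^ (i.1.2.2 - i.1.2.1)) (bgOfCfg i.1.1 i.1.2.2 U₀)) →
        NegSize (i.1.1.L : ℝ) (((i.1.1.L : ℝ)⁻¹) ^ (i.1.2.2 - i.1.2.1)) (fun _ : Bond 3 (periodsT3 i.1.1 i.1.2.2) => i.1.2.2 - i.1.2.1) 3 (Matrix (Fin 2) (Fin 2) ℂ))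
    (H₁f : ∀ (L : ℕ) (i : Idx L) (U₀ : GaugeField (i.1.1.P i.1.2.2) 0 (Matrix.specialUnitaryGroup (Fin 2) ℂ)),
      (PBond (i.1.1.P i.1.2.1) 0 → Matrix (Fin 2) (Fin 2) ℂ) →L[ℂ]
        Space115 (i.1.1.L : ℝ) (((i.1.1.L : ℝ)⁻¹) ^ (i.1.2.2 - i.1.2.1)) (fun _ : Bond 3 (periodsT3 i.1.1 i.1.2.2) => i.1.2.2 - i.1.2.1)
          (fun _ : Bond 3 (periodsT3 i.1.1 i.1.2.2) × Fin 3 => i.1.2.2 - i.1.2.1) (nabla115 (((i.1.1.L : ℝ)⁻¹) ^ (i.1.2.2 - i.1.2.1)) (bgOfCfg i.1.1 i.1.2.2 U₀)))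
    -- their displayed bounds (the `SectEDatum` fields at admissible backgrounds)
    (norm_G : ∀ (L : ℕ), 1 < L → ∀ (i : Idx L) (ρ : ℝ) (U₀ : GaugeField (i.1.1.P i.1.2.2) 0 (Matrix.specialUnitaryGroup (Fin 2) ℂ)),
      RegPr i.1.1 i.1.2.1 i.1.2.2 ρ U₀ → ρ ≤ α L → ∀ f, ‖𝒢f L i U₀ f‖ ≤ B₀ L * ‖f‖)
    (prop4 : ∀ (L : ℕ), 1 < L → ∀ (i : Idx L) (ρ : ℝ) (U₀ : GaugeField (i.1.1.P i.1.2.2) 0 (Matrix.specialUnitaryGroup (Fin 2) ℂ)),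
      RegPr i.1.1 i.1.2.1 i.1.2.2 ρ U₀ → ρ ≤ α L → QuadAnalytic (Wf L i U₀) (C₄ L) (a₃ L))
    (norm_H₁ : ∀ (L : ℕ), 1 < L → ∀ (i : Idx L) (ρ : ℝ) (U₀ : GaugeField (i.1.1.P i.1.2.2) 0 (Matrix.specialUnitaryGroup (Fin 2) ℂ)),
      RegPr i.1.1 i.1.2.1 i.1.2.2 ρ U₀ → ρ ≤ α L → ∀ b, ‖H₁f L i U₀ b‖ ≤ B₀ L * ‖b‖)
    -- (45)–(46)-twˢ AT ITS η-ORDER, against the chart of record `Q := QTwS U₀`: print's letter `H` — `QH = I`, `RD*H = 0` (45), `‖HY‖ ≤ B_H·η·‖Y‖` (46), η = L^{−(K−n)} (DISPLAYED; supplier of record: [Balaban1985BackgroundPropagators]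
    -- Thm 3.12 for `H` (3.126), (3.133) n = 0,1 ⊕ (2.61); T³ statement p607026 `normH₁_row_of_recordObligations` with `Hsel := Hk`; O(η) = pure scaling `H_route = η·H_print`)
    (BH : ℕ → ℝ)
    (h46tw : ∀ (L : ℕ), 1 < L → ∀ (i : Idx L) (U₀ : GaugeField (i.1.1.P i.1.2.2) 0 (Matrix.specialUnitaryGroup (Fin 2) ℂ)), RegPr i.1.1 i.1.2.1 i.1.2.2 (α L) U₀ →
      ∃ H : (PBond (i.1.1.P i.1.2.1) 0 → Matrix (Fin 2) (Fin 2) ℂ) →ₗ[ℂ] (PBond (i.1.1.P i.1.2.2) 0 → Matrix (Fin 2) (Fin 2) ℂ),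
        (∀ Y, QTwS i.1.1 i.1.2.1 i.1.2.2 i.2.2.le U₀ (H Y) = Y) ∧ (∀ Y, IsLandauPrint i.1.1 i.1.2.1 i.1.2.2 U₀ (H Y)) ∧
        ∀ Y, ‖H Y‖ ≤ BH L * eta i.1.1 i.1.2.1 i.1.2.2 * ‖Y‖)
    -- the radius `e L` of the witness ∕ window theorems and the two L-only numerals (WF) of ✓`Prop7DbarTwSymWindow` ∕ ✓`Prop7CmapTwSymInputs` ∕ ✓`Prop7SymSliceWitnessRegPr`
    (ef : ℕ → ℝ) (hef : ∀ L, 1 < L → 0 < ef L)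
    (hWe : ∀ L : ℕ, 1 < L → 10 ^ 9 * (L : ℝ) ^ 2 * ef L ≤ 1) (hWε : ∀ L : ℕ, 1 < L → 10 ^ 12 * (L : ℝ) ^ 3 * α L ≤ 1)
    -- the size window linking (CH5EL-twˢ)'s size row to the witness ∕ window radius, and the regularity window of the chart point
    (hMe : ∀ L, 1 < L → M L * (r L + 2 * B₀ L * α L) < ef L)
    (hw137 : ∀ L : ℕ, 1 < L → 10 ^ 7 * (L : ℝ) ^ 3 * (178 * (α L + ef L)) ≤ 1)
    -- (CH47-twˢ) IS A THEOREM here (✓`Prop7CmapTwSymInputs.chart47twS_of_regPr_eta`): Prop. 3 for the chart of record at `C₂ := 40M₀ˢ∕(e·η)²`, `M₀ˢ = 6(2e + 2700Lε₀)`, radius `η·ε′`; its two η-free windows are displayed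
    (ε' : ℕ → ℝ) (hBH0 : ∀ L : ℕ, 1 < L → 0 ≤ BH L)
    (hq47 : ∀ L : ℕ, 1 < L → 9 * (40 * (2 * (3 * (2 * ef L + 2700 * (L : ℝ) * α L))) / ef L ^ 2) * BH L * ε' L < 1)
    (hR6 : ∀ L : ℕ, 1 < L → 6 * ε' L ≤ ef L)
    -- (102)-twS «Q𝔊 = 0» and (129)-twS «QH₁ = id» for print's `Q(U₀) = η·(QTwS U₀ ∘ ι)`, read through the (115)-space dictionary `ι` (DISPLAYED, N06-class rows about the opaque letters)
    (h102 : ∀ (L : ℕ), 1 < L → ∀ (i : Idx L) (U₀ : GaugeField (i.1.1.P i.1.2.2) 0 (Matrix.specialUnitaryGroup (Fin 2) ℂ)), RegPr i.1.1 i.1.2.1 i.1.2.2 (α L) U₀ →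
      ∀ f : NegSize (i.1.1.L : ℝ) (((i.1.1.L : ℝ)⁻¹) ^ (i.1.2.2 - i.1.2.1)) (fun _ : Bond 3 (periodsT3 i.1.1 i.1.2.2) => i.1.2.2 - i.1.2.1) 3 (Matrix (Fin 2) (Fin 2) ℂ),
        QTwS i.1.1 i.1.2.1 i.1.2.2 i.2.2.le U₀ (fun b : PBond (i.1.1.P i.1.2.2) 0 => JetSup.equiv _ _ _ (𝒢f L i U₀ f) (bondEquiv i.1.1 i.1.2.2 b)) = 0)
    (h129 : ∀ (L : ℕ), 1 < L → ∀ (i : Idx L) (U₀ : GaugeField (i.1.1.P i.1.2.2) 0 (Matrix.specialUnitaryGroup (Fin 2) ℂ)), RegPr i.1.1 i.1.2.1 i.1.2.2 (α L) U₀ →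
      ∀ B : PBond (i.1.1.P i.1.2.1) 0 → Matrix (Fin 2) (Fin 2) ℂ,
        QTwS i.1.1 i.1.2.1 i.1.2.2 i.2.2.le U₀ (fun b : PBond (i.1.1.P i.1.2.2) 0 => JetSup.equiv _ _ _ (H₁f L i U₀ B) (bondEquiv i.1.1 i.1.2.2 b)) =
          fun c => (((eta i.1.1 i.1.2.1 i.1.2.2 : ℝ) : ℂ))⁻¹ • B c)
    -- (102)-L «RD*𝔊 = 0» and (129)-L «RD*H₁ = 0» ((3.124)) in the route's (1.38)-form `IsLandauPrint`, read through `ι` (DISPLAYED, N06-class letters of the same storey)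
    (h102L : ∀ (L : ℕ), 1 < L → ∀ (i : Idx L) (U₀ : GaugeField (i.1.1.P i.1.2.2) 0 (Matrix.specialUnitaryGroup (Fin 2) ℂ)), RegPr i.1.1 i.1.2.1 i.1.2.2 (α L) U₀ →
      ∀ f : NegSize (i.1.1.L : ℝ) (((i.1.1.L : ℝ)⁻¹) ^ (i.1.2.2 - i.1.2.1)) (fun _ : Bond 3 (periodsT3 i.1.1 i.1.2.2) => i.1.2.2 - i.1.2.1) 3 (Matrix (Fin 2) (Fin 2) ℂ),
        IsLandauPrint i.1.1 i.1.2.1 i.1.2.2 U₀ (fun b : PBond (i.1.1.P i.1.2.2) 0 => JetSup.equiv _ _ _ (𝒢f L i U₀ f) (bondEquiv i.1.1 i.1.2.2 b)))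
    (h129L : ∀ (L : ℕ), 1 < L → ∀ (i : Idx L) (U₀ : GaugeField (i.1.1.P i.1.2.2) 0 (Matrix.specialUnitaryGroup (Fin 2) ℂ)), RegPr i.1.1 i.1.2.1 i.1.2.2 (α L) U₀ →
      ∀ B : PBond (i.1.1.P i.1.2.1) 0 → Matrix (Fin 2) (Fin 2) ℂ,
        IsLandauPrint i.1.1 i.1.2.1 i.1.2.2 U₀ (fun b : PBond (i.1.1.P i.1.2.2) 0 => JetSup.equiv _ _ _ (H₁f L i U₀ B) (bondEquiv i.1.1 i.1.2.2 b)))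
    -- the chart-radius window (exponent scale): print's `A′ = A₁ + H₁B` of (103) lies in the `ε₃`-ball of Prop. 3-tw, `η(r + 2B₀α) ≤ ε₃`
    (hrε : ∀ L : ℕ, 1 < L → r L + 2 * B₀ L * α L ≤ ε' L)
    -- (CH5EL-twˢ)″: (112) ∘ Prop. 5 (reality) ∘ (123)–(140) ((19)-size) ∘ E–L (at the `NormS`-representatives) at print's `A′ = A₁ + H₁B` in the exponent scale `iη·(ι A₁ + ι(H₁B))`, for the `H` of (45)–(46)-twˢ, chart remainder `Dfix (CmapTwS U₀)` (DISPLAYED, XL; no (20), (21), datum)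
    (hXtw'' : ∀ (L : ℕ), 1 < L → ∀ (i : Idx L) (ε₁ : ℝ) (V : GaugeField (i.1.1.P i.1.2.1) 0 (Matrix.specialUnitaryGroup (Fin 2) ℂ))
      (U₀ : GaugeField (i.1.1.P i.1.2.2) 0 (Matrix.specialUnitaryGroup (Fin 2) ℂ))
      (H : (PBond (i.1.1.P i.1.2.1) 0 → Matrix (Fin 2) (Fin 2) ℂ) →ₗ[ℂ] (PBond (i.1.1.P i.1.2.2) 0 → Matrix (Fin 2) (Fin 2) ℂ)), 0 < ε₁ → PlaqSmall ε₁ V →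
      RegPr i.1.1 i.1.2.1 i.1.2.2 ((L : ℝ) ^ 3 * (3 * (L : ℝ)) * ε₁) U₀ → CloseAvg i.1.1 i.1.2.1 i.1.2.2 i.2.2.le ((L : ℝ) ^ 3 * ε₁) V U₀ → (L : ℝ) ^ 3 * (3 * (L : ℝ)) * ε₁ ≤ α L →
      (∀ Y, QTwS i.1.1 i.1.2.1 i.1.2.2 i.2.2.le U₀ (H Y) = Y) → (∀ Y, IsLandauPrint i.1.1 i.1.2.1 i.1.2.2 U₀ (H Y)) →
      (∀ Y, ‖H Y‖ ≤ BH L * eta i.1.1 i.1.2.1 i.1.2.2 * ‖Y‖) → Chart47T3twS i.1.1 i.1.2.1 i.1.2.2 i.2.2.le (40 * (2 * (3 * (2 * ef L + 2700 * (i.1.1.L : ℝ) * α L))) / (ef L * eta i.1.1 i.1.2.1 i.1.2.2) ^ 2) (eta i.1.1 i.1.2.1 i.1.2.2 * ε' L) U₀ H →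
      ∀ A₁ : Space115 (i.1.1.L : ℝ) (((i.1.1.L : ℝ)⁻¹) ^ (i.1.2.2 - i.1.2.1)) (fun _ : Bond 3 (periodsT3 i.1.1 i.1.2.2) => i.1.2.2 - i.1.2.1)
          (fun _ : Bond 3 (periodsT3 i.1.1 i.1.2.2) × Fin 3 => i.1.2.2 - i.1.2.1) (nabla115 (((i.1.1.L : ℝ)⁻¹) ^ (i.1.2.2 - i.1.2.1)) (bgOfCfg i.1.1 i.1.2.2 U₀)),
        ‖A₁‖ < r L →
        A₁ + 𝒢f L i U₀ (Jcur (bgOfCfg i.1.1 i.1.2.2 U₀)) + 𝒢f L i U₀ (Wf L i U₀ (A₁ + H₁f L i U₀ (fun c : PBond (i.1.1.P i.1.2.1) 0 =>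
          (-Complex.I) • mlog (((V c : Matrix.specialUnitaryGroup (Fin 2) ℂ) : Matrix (Fin 2) (Fin 2) ℂ)
            * star ((descendTo i.1.1 ℰp i.1.2.1 i.1.2.2 i.2.2.le U₀ c : Matrix.specialUnitaryGroup (Fin 2) ℂ) : Matrix (Fin 2) (Fin 2) ℂ))))) = 0 →
        ∃ X : PBond (i.1.1.P i.1.2.2) 0 → Matrix (Fin 2) (Fin 2) ℂ,
          (∀ b : PBond (i.1.1.P i.1.2.2) 0, (X b).IsHermitian ∧ Matrix.trace (X b) = 0) ∧
          (((eta i.1.1 i.1.2.1 i.1.2.2 : ℝ) : ℂ) * Complex.I) • ((fun b : PBond (i.1.1.P i.1.2.2) 0 => JetSup.equiv _ _ _ A₁ (bondEquiv i.1.1 i.1.2.2 b))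
              + (fun b : PBond (i.1.1.P i.1.2.2) 0 => JetSup.equiv _ _ _ (H₁f L i U₀ (fun c : PBond (i.1.1.P i.1.2.1) 0 =>
          (-Complex.I) • mlog (((V c : Matrix.specialUnitaryGroup (Fin 2) ℂ) : Matrix (Fin 2) (Fin 2) ℂ)
            * star ((descendTo i.1.1 ℰp i.1.2.1 i.1.2.2 i.2.2.le U₀ c : Matrix.specialUnitaryGroup (Fin 2) ℂ) : Matrix (Fin 2) (Fin 2) ℂ)))) (bondEquiv i.1.1 i.1.2.2 b)))
            - H (Dfix (CmapTwS i.1.1 i.1.2.1 i.1.2.2 i.2.2.le U₀) H (40 * (2 * (3 * (2 * ef L + 2700 * (i.1.1.L : ℝ) * α L))) / (ef L * eta i.1.1 i.1.2.1 i.1.2.2) ^ 2)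
              ((((eta i.1.1 i.1.2.1 i.1.2.2 : ℝ) : ℂ) * Complex.I) • ((fun b : PBond (i.1.1.P i.1.2.2) 0 => JetSup.equiv _ _ _ A₁ (bondEquiv i.1.1 i.1.2.2 b))
              + (fun b : PBond (i.1.1.P i.1.2.2) 0 => JetSup.equiv _ _ _ (H₁f L i U₀ (fun c : PBond (i.1.1.P i.1.2.1) 0 =>
          (-Complex.I) • mlog (((V c : Matrix.specialUnitaryGroup (Fin 2) ℂ) : Matrix (Fin 2) (Fin 2) ℂ)
            * star ((descendTo i.1.1 ℰp i.1.2.1 i.1.2.2 i.2.2.le U₀ c : Matrix.specialUnitaryGroup (Fin 2) ℂ) : Matrix (Fin 2) (Fin 2) ℂ)))) (bondEquiv i.1.1 i.1.2.2 b)))))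
            = (fun b => Complex.I • X b) ∧
          nMax19 i.1.1 i.1.2.1 i.1.2.2 U₀ X ≤ M L * (‖A₁‖ + ‖H₁f L i U₀ (fun c : PBond (i.1.1.P i.1.2.1) 0 =>
          (-Complex.I) • mlog (((V c : Matrix.specialUnitaryGroup (Fin 2) ℂ) : Matrix (Fin 2) (Fin 2) ℂ)
            * star ((descendTo i.1.1 ℰp i.1.2.1 i.1.2.2 i.2.2.le U₀ c : Matrix.specialUnitaryGroup (Fin 2) ℂ) : Matrix (Fin 2) (Fin 2) ℂ)))‖) ∧
          (∀ u : GaugeTransf (i.1.1.P i.1.2.2) 0 (Matrix.specialUnitaryGroup (Fin 2) ℂ), NormS i.1.1 i.1.2.1 i.1.2.2 i.2.2.le U₀ X (expHermField X) u →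
            GaugeField.gaugeAct u (emb15 U₀ (expHermField X)) ∈ fibre i.1.1 ℰp i.1.2.1 i.1.2.2 i.2.2.le V →
            ∀ γ : ℝ → GaugeField (i.1.1.P i.1.2.2) 0 (Matrix.specialUnitaryGroup (Fin 2) ℂ), γ 0 = GaugeField.gaugeAct u (emb15 U₀ (expHermField X)) →
              (∀ t, γ t ∈ fibre i.1.1 ℰp i.1.2.1 i.1.2.2 i.2.2.le V) →
              (∀ b, DifferentiableAt ℝ (fun t => ((γ t b : Matrix.specialUnitaryGroup (Fin 2) ℂ) : Matrix (Fin 2) (Fin 2) ℂ)) 0) →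
                deriv (fun t => wilsonAction4 (γ t)) 0 = 0))
    -- (ii) the (γ)-input of ★w4's `growth142_T3`, displayed member-uniformly (verbatim from the v1 knit)
    (hGrowth : ∀ (L : ℕ), 1 < L → ∀ (i : Idx L) (ε₁ ε₄ : ℝ) (V : GaugeField (i.1.1.P i.1.2.1) 0 (Matrix.specialUnitaryGroup (Fin 2) ℂ))
      (U₀ : GaugeField (i.1.1.P i.1.2.2) 0 (Matrix.specialUnitaryGroup (Fin 2) ℂ)) (X : PBond (i.1.1.P i.1.2.2) 0 → Matrix (Fin 2) (Fin 2) ℂ)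
      (u : GaugeTransf (i.1.1.P i.1.2.2) 0 (Matrix.specialUnitaryGroup (Fin 2) ℂ)) (W : GaugeField (i.1.1.P i.1.2.2) 0 (Matrix.specialUnitaryGroup (Fin 2) ℂ)),
      0 < ε₁ → ε₄ ≤ 1 / 4 → (L : ℝ) ^ 3 * (3 * (L : ℝ)) * ε₁ ≤ ε₄ → PlaqSmall ε₁ V → RegPr i.1.1 i.1.2.1 i.1.2.2 ((L : ℝ) ^ 3 * (3 * (L : ℝ)) * ε₁) U₀ →
      CloseAvg i.1.1 i.1.2.1 i.1.2.2 i.2.2.le ((L : ℝ) ^ 3 * ε₁) V U₀ → (∀ b : PBond (i.1.1.P i.1.2.2) 0, (X b).IsHermitian ∧ Matrix.trace (X b) = 0) →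
      nMax19 i.1.1 i.1.2.1 i.1.2.2 U₀ X < ε₄ → AvgCondPrintS i.1.1 i.1.2.1 i.1.2.2 i.2.2.le V U₀ X → IsLandauPrint i.1.1 i.1.2.1 i.1.2.2 U₀ X →
      NormS i.1.1 i.1.2.1 i.1.2.2 i.2.2.le U₀ X (expHermField X) u → W = GaugeField.gaugeAct u (emb15 U₀ (expHermField X)) →
      W ∈ fibre i.1.1 ℰp i.1.2.1 i.1.2.2 i.2.2.le V →
      (∀ γ : ℝ → GaugeField (i.1.1.P i.1.2.2) 0 (Matrix.specialUnitaryGroup (Fin 2) ℂ), γ 0 = W → (∀ t, γ t ∈ fibre i.1.1 ℰp i.1.2.1 i.1.2.2 i.2.2.le V) →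
        (∀ b, DifferentiableAt ℝ (fun t => ((γ t b : Matrix.specialUnitaryGroup (Fin 2) ℂ) : Matrix (Fin 2) (Fin 2) ℂ)) 0) →
          deriv (fun t => wilsonAction4 (γ t)) 0 = 0) →
      ∀ W' : GaugeField (i.1.1.P i.1.2.2) 0 (Matrix.specialUnitaryGroup (Fin 2) ℂ), W' ∈ regFibrePr i.1.1 i.1.2.1 i.1.2.2 i.2.2.le (178 * ε₄) V →
        ∃ g : GaugeTransf (i.1.1.P i.1.2.2) 0 (Matrix.specialUnitaryGroup (Fin 2) ℂ), descTransf i.1.1 i.1.2.1 i.1.2.2 i.2.2.le g = (fun _ => 1) ∧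
          (∑ b : PBond (i.1.1.P i.1.2.2) 0, ‖pertVar W (GaugeField.gaugeAct g W') b‖ ^ 2 ≤
            CP L * ((i.1.1.L : ℝ) ^ (i.1.2.2 - i.1.2.1)) ^ 2 * ∑ p : Plaq (i.1.1.P i.1.2.2) 0,
              ‖((GaugeField.plaqHol (GaugeField.gaugeAct g W') p : Matrix.specialUnitaryGroup (Fin 2) ℂ) : Matrix (Fin 2) (Fin 2) ℂ)
                  * star ((GaugeField.plaqHol W p : Matrix.specialUnitaryGroup (Fin 2) ℂ) : Matrix (Fin 2) (Fin 2) ℂ) - 1‖ ^ 2) ∧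
          (-(θ L * ∑ p : Plaq (i.1.1.P i.1.2.2) 0,
              ‖((GaugeField.plaqHol (GaugeField.gaugeAct g W') p : Matrix.specialUnitaryGroup (Fin 2) ℂ) : Matrix (Fin 2) (Fin 2) ℂ)
                  * star ((GaugeField.plaqHol W p : Matrix.specialUnitaryGroup (Fin 2) ℂ) : Matrix (Fin 2) (Fin 2) ℂ) - 1‖ ^ 2) -
              (cS L * ε₄ * (((i.1.1.L : ℝ) ^ (i.1.2.2 - i.1.2.1)) ^ 2)⁻¹) * ∑ b : PBond (i.1.1.P i.1.2.2) 0, ‖pertVar W (GaugeField.gaugeAct g W') b‖ ^ 2 ≤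
            ∑ p : Plaq (i.1.1.P i.1.2.2) 0, (1 / 2) * ((((((GaugeField.plaqHol W p : Matrix.specialUnitaryGroup (Fin 2) ℂ) : Matrix (Fin 2) (Fin 2) ℂ)) - 1)ᴴ
              * (((((GaugeField.gaugeAct g W' ⟨p.src, p.μ⟩ : Matrix.specialUnitaryGroup (Fin 2) ℂ) : Matrix (Fin 2) (Fin 2) ℂ) * star (W ⟨p.src, p.μ⟩ : Matrix (Fin 2) (Fin 2) ℂ) - 1)
                  + (W ⟨p.src, p.μ⟩ : Matrix (Fin 2) (Fin 2) ℂ)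
                      * (((GaugeField.gaugeAct g W' ⟨p.src.shift p.μ, p.ν⟩ : Matrix.specialUnitaryGroup (Fin 2) ℂ) : Matrix (Fin 2) (Fin 2) ℂ) *
                          star (W ⟨p.src.shift p.μ, p.ν⟩ : Matrix (Fin 2) (Fin 2) ℂ) - 1)
                      * star (W ⟨p.src, p.μ⟩ : Matrix (Fin 2) (Fin 2) ℂ)
                  - ((W ⟨p.src, p.μ⟩ * W ⟨p.src.shift p.μ, p.ν⟩ * (W ⟨p.src.shift p.ν, p.μ⟩)⁻¹ : Matrix.specialUnitaryGroup (Fin 2) ℂ) :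
                        Matrix (Fin 2) (Fin 2) ℂ)
                      * (((GaugeField.gaugeAct g W' ⟨p.src.shift p.ν, p.μ⟩ : Matrix.specialUnitaryGroup (Fin 2) ℂ) : Matrix (Fin 2) (Fin 2) ℂ) *
                          star (W ⟨p.src.shift p.ν, p.μ⟩ : Matrix (Fin 2) (Fin 2) ℂ) - 1)
                      * star ((W ⟨p.src, p.μ⟩ * W ⟨p.src.shift p.μ, p.ν⟩ * (W ⟨p.src.shift p.ν, p.μ⟩)⁻¹ : Matrix.specialUnitaryGroup (Fin 2) ℂ) :
                        Matrix (Fin 2) (Fin 2) ℂ)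
                  - ((GaugeField.plaqHol W p : Matrix.specialUnitaryGroup (Fin 2) ℂ) : Matrix (Fin 2) (Fin 2) ℂ)
                      * (((GaugeField.gaugeAct g W' ⟨p.src, p.ν⟩ : Matrix.specialUnitaryGroup (Fin 2) ℂ) : Matrix (Fin 2) (Fin 2) ℂ) * star (W ⟨p.src, p.ν⟩ : Matrix (Fin 2) (Fin 2) ℂ) - 1)
                      * star ((GaugeField.plaqHol W p : Matrix.specialUnitaryGroup (Fin 2) ℂ) : Matrix (Fin 2) (Fin 2) ℂ))
                * ((GaugeField.plaqHol W p : Matrix.specialUnitaryGroup (Fin 2) ℂ) : Matrix (Fin 2) (Fin 2) ℂ))).trace).re))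
    -- (T2) the [B8] Thm 2 torus sockets, one `(B₁, c₁)` per `L`
    (hThm2 : ∀ (L : ℕ), 1 < L → ∃ B₁ c₁ : ℝ, 0 < B₁ ∧ 0 < c₁ ∧ ∀ (F : T3Family), F.L = L → ∀ (n K : ℕ), n < K →
      ∃ (β₀ B₂ : ℝ) (len : B7Prop1Explicit.Site (F.P K).d → ℝ),
        Thm2TorusAt (F.P K).L (K - n) ((((F.P K).sitesPerDir 0 : ℕ) : ℤ)) (eta F n K) β₀ B₁ B₂ c₁ len (specialUnitaryUnits (Fin 2)) (fun _ => True)) :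
    ∀ (L : ℕ), 1 < L → ∀ (B₃ : ℝ), 4 < B₃ → ∃ a₁' O₁ : ℝ, 0 < a₁' ∧ 1 ≤ O₁ ∧
    ∀ (F : T3Family), F.L = L → ∀ (n K : ℕ) (hnK : n < K) (ε₁ : ℝ), 0 < ε₁ →
      ∀ V : GaugeField (F.P n) 0 (Matrix.specialUnitaryGroup (Fin 2) ℂ), PlaqSmall ε₁ V →
        ∀ U₀ : GaugeField (F.P K) 0 (Matrix.specialUnitaryGroup (Fin 2) ℂ), RegPr F n K ((L : ℝ) ^ 3 * B₃ * ε₁) U₀ → U₀ ∈ fibre F ℰp n K hnK.le V →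
          ε₁ ≤ a₁' → ∃ U ∈ regFibrePr F n K hnK.le (O₁ * (L : ℝ) ^ 3 * B₃ * ε₁) V,
            IsMinOn (fun W : GaugeField (F.P K) 0 (Matrix.specialUnitaryGroup (Fin 2) ℂ) => wilsonAction4 W)
              (regFibrePr F n K hnK.le (O₁ * (L : ℝ) ^ 3 * B₃ * ε₁) V) U := by
  refine stubEX_of_chartPiecesTwS B₀ C₄ a₃ α r M CP θ cS hB₀ hC₄ ha₃ hα hr hM hCP hθ hcS 𝒢f Wf H₁f norm_G prop4 norm_H₁ BH h46tw ef hef hWe hWε ?_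
    hMe hw137 ε' hBH0 hq47 hR6 h102 h129 h102L h129L hrε hXtw'' hGrowth hThm2
  -- CHART-ΣS WITNESS DISCHARGED (★w5-20520 g4's `exists_normS_of_regPr_of_size`, ✓p620841): the chart point `e^{iX}U₀` is printed-regular of radius `178(α + e)` ([Balaban1985RegularSpaces] Prop. 7)
  intro L hL i U₀ hregα X hX hlt
  have hFL' : (i.1.1.L : ℝ) = (L : ℝ) := by exact_mod_cast i.2.1
  have hα0 : 0 < α L := hα L hL
  have he0 : 0 < ef L := hef L hL
  have hWe' : 10 ^ 9 * (i.1.1.L : ℝ) ^ 2 * ef L ≤ 1 := by rw [hFL']; exact hWe L hL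
  have hWε' : 10 ^ 12 * (i.1.1.L : ℝ) ^ 3 * α L ≤ 1 := by rw [hFL']; exact hWε L hL
  have hw137' : 10 ^ 7 * (i.1.1.L : ℝ) ^ 3 * (178 * (α L + ef L)) ≤ 1 := by rw [hFL']; exact hw137 L hL
  obtain ⟨s3, s4⟩ := windows_of_W (three_le_memberL i) hα0.le he0.le hWe' hWε'
  have hε₂ : α L + ef L ≤ 1 / 4 := by linarith
  have h19 : In19 i.1.1 i.1.2.1 i.1.2.2 (α L + ef L) U₀ (expHermField X) X := in19_expHermField_of_nMax19_lt hX (hlt.trans_le (by linarith))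
  have hU₁ : RegPr i.1.1 i.1.2.1 i.1.2.2 (178 * (α L + ef L)) (emb15 U₀ (expHermField X)) :=
    regPr_emb15_of_in19 i.1.1 i.1.2.1 i.1.2.2 hε₂ (by linarith) hregα h19
  have hXe : ∀ b : PBond (i.1.1.P i.1.2.2) 0, ‖X b‖ ≤ ef L * eta i.1.1 i.1.2.1 i.1.2.2 := fun b => by
    have h1 := norm_smul_I_le_of_nMax19_lt i.1.1 hlt b
    rwa [norm_smul, Complex.norm_I, one_mul] at h1
  exact exists_normS_of_regPr_of_size i.1.1 i.2.2.le hα0 hWε' (by positivity) hw137' he0.le hWe' hregα hX hXe hU₁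

end Summit.QuantumFields.YangMills.Theorems.Prop7StubEXOfChartPiecesTwSW

end
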